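import Literature.MathematicalPhysics.QuantumManyBody.BoseEinsteinCondensation
import Literature.MathematicalPhysics.QuantumManyBody.SwapPurity

/-!
# Route `BECThomsonPrinciple`, crux `PeriodicToDirichlet` (stmt-AtomisticToContinuum-9483),
# line `Sketch` (torus-in-the-box-doob): registered stub `stub_estimatorFloor` (G1)

The estimator identity and the event bound of the Doob decomposition: for a nonnegative measurable
`N = m+1`-body function `Ψ`, a measurable set `C ⊂ ℝ³` of finite volume and any real function `Φ`,
the flat-mode occupation of `C` in `Ψ` is at least `N κ μ` times the `Ψ²`-mass of the event
"particle `0` in `C`, `μ|C|Φ(X) ≤ ∫_C Φ(·,X̂)`, `Φ(X) > 0` and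
`(∫_C Ψ(·,X̂)) Φ(X) ≥ κ (∫_C Φ(·,X̂)) Ψ(X)`" — because on that event `∫_C Ψ(·,X̂) ≥ κμ|C| Ψ(X)`,
while `n_C(Ψ)/N = |C|⁻¹ ∫ 1_C(x₀) Ψ(X) (∫_C Ψ(·,X̂)) dX` (Tonelli in `X = x₀ :: X̂`). [folklore]
-/

noncomputable section

open MeasureTheory Filter
open scoped ENNReal NNReal ComplexConjugate

namespace Summit.AtomisticToContinuum.BoseEinsteinCondensation.TorusInTheBox

open Literature.MathematicalPhysics.QuantumManyBody.BoseGas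

/-! ### Measurability of the fibre integrals `∫_C Ψ(x :: X̂) dx` -/

/-- `X ↦ ∫_C Ψ(x :: tail X) dx` is measurable for measurable real `Ψ` (Fubini integrand).
[folklore] -/
private theorem measurable_setIntegral_vecCons_tail {n : ℕ} {Ψ : Config (n + 1) → ℝ}
    (hΨ : Measurable Ψ) (C : Set Space) :
    Measurable fun X : Config (n + 1) => ∫ x in C, Ψ (Matrix.vecCons x (Fin.tail X)) := by
  have h : StronglyMeasurable (Function.uncurry fun (X : Config (n + 1)) (x : Space) =>
      Ψ (Matrix.vecCons x (Fin.tail X))) := by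
    refine Measurable.stronglyMeasurable ?_
    exact hΨ.comp (continuous_snd.matrixVecCons
      (continuous_pi fun i => (continuous_apply i.succ).comp continuous_fst)).measurable
  exact (h.integral_prod_right' (ν := (volume.restrict C : Measure Space))).measurable

/-! ### Tonelli in `X = x₀ :: X̂` for integrands supported in `{x₀ ∈ C}` -/

/-- `∫ 1_C(X 0) G(X) dX = ∫ dŶ ∫_C dx G(x :: Ŷ)` for measurable `G ≥ 0` on `(ℝ³)^{n+1}`.
[folklore] -/
private theorem lintegral_indicator_head_mem {n : ℕ} {C : Set Space} (hC : MeasurableSet C)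
    {G : Config (n + 1) → ℝ≥0∞} (hG : Measurable G) :
    ∫⁻ X, {X : Config (n + 1) | X 0 ∈ C}.indicator G X =
      ∫⁻ Y : Config n, ∫⁻ x in C, G (Matrix.vecCons x Y) := by
  have hT : MeasurableSet {X : Config (n + 1) | X 0 ∈ C} := measurable_pi_apply 0 hC
  rw [lintegral_config_succ (hG.indicator hT)]
  refine lintegral_congr fun Y => ?_
  rw [← lintegral_indicator hC]
  refine lintegral_congr fun x => ?_
  by_cases hx : x ∈ C <;> simp [Set.indicator, hx]

/-- `(∫ f)² = (∫⁻ f) · (∫ f)` in `[0, ∞]` for `f ≥ 0` (both sides vanish if `f` is not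
integrable). [folklore] -/
private theorem ofReal_integral_sq {α : Type*} [MeasurableSpace α] {ν : Measure α} {f : α → ℝ}
    (hf : ∀ a, 0 ≤ f a) :
    ENNReal.ofReal (∫ a, f a ∂ν) ^ 2 =
      (∫⁻ a, ENNReal.ofReal (f a) ∂ν) * ENNReal.ofReal (∫ a, f a ∂ν) := by
  by_cases hfi : Integrable f ν
  · rw [sq, ofReal_integral_eq_lintegral_ofReal hfi (ae_of_all _ hf)]
  · simp [integral_undef hfi]

/-- **Tonelli form of `∫ dŶ (∫_C Ψ(x :: Ŷ) dx)²`**: for measurable `Ψ ≥ 0` it equals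
`∫ 1_C(X 0) Ψ(X) (∫_C Ψ(x :: X̂) dx) dX`, `X̂ = tail X`. [folklore] -/
private theorem lintegral_sq_fibre_eq {n : ℕ} {C : Set Space} (hC : MeasurableSet C)
    {Ψ : Config (n + 1) → ℝ} (hΨm : Measurable Ψ) (hΨ0 : ∀ X, 0 ≤ Ψ X) :
    ∫⁻ Y : Config n, ENNReal.ofReal (∫ x in C, Ψ (Matrix.vecCons x Y)) ^ 2 =
      ∫⁻ X : Config (n + 1), {X : Config (n + 1) | X 0 ∈ C}.indicator
        (fun X => ENNReal.ofReal (Ψ X) *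
          ENNReal.ofReal (∫ x in C, Ψ (Matrix.vecCons x (Fin.tail X)))) X := by
  have hGm : Measurable fun X : Config (n + 1) => ENNReal.ofReal (Ψ X) *
      ENNReal.ofReal (∫ x in C, Ψ (Matrix.vecCons x (Fin.tail X))) :=
    hΨm.ennreal_ofReal.mul (measurable_setIntegral_vecCons_tail hΨm C).ennreal_ofReal
  rw [lintegral_indicator_head_mem hC hGm]
  refine lintegral_congr fun Y => ?_
  simp only [Fin.tail_vecCons]
  rw [lintegral_mul_const' _ _ ENNReal.ofReal_ne_top]
  exact ofReal_integral_sq fun x => hΨ0 _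

/-! ### The estimator identity for the flat mode `φ_C = |C|^{-1/2} 1_C` -/

/-- The pairing of `s 1_C` with a real slice: `∫ conj(s 1_C(x)) Ψ(x :: Ŷ) dx = s ∫_C Ψ(x :: Ŷ) dx`
(a real number cast to `ℂ`; both sides vanish if the slice is not integrable on `C`).
[folklore] -/
private theorem integral_conj_indicator_const_mul {n : ℕ} {C : Set Space} (hC : MeasurableSet C)
    (s : ℝ) (Ψ : Config (n + 1) → ℝ) (Y : Config n) :
    ∫ x, conj (C.indicator (fun _ => (s : ℂ)) x) * (Ψ (Matrix.vecCons x Y) : ℂ) =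
      ((s * ∫ x in C, Ψ (Matrix.vecCons x Y) : ℝ) : ℂ) := by
  have h : ∀ x, conj (C.indicator (fun _ => (s : ℂ)) x) * (Ψ (Matrix.vecCons x Y) : ℂ) =
      C.indicator (fun x => ((s * Ψ (Matrix.vecCons x Y) : ℝ) : ℂ)) x := by
    intro x
    by_cases hx : x ∈ C <;> simp [hx, Complex.conj_ofReal]
  simp_rw [h, integral_indicator hC, integral_complex_ofReal, integral_const_mul]

/-- `|r|² = r²` in `[0, ∞]` for a real number seen in `ℂ`. [folklore] -/
private theorem sq_nnnorm_ofReal (r : ℝ) :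
    ((‖(r : ℂ)‖₊ : ℝ≥0∞)) ^ 2 = ENNReal.ofReal (r ^ 2) := by
  rw [← enorm_eq_nnnorm, ← ofReal_norm, Complex.norm_real, Real.norm_eq_abs,
    ← ENNReal.ofReal_pow (abs_nonneg _), sq_abs]

/-- **The estimator identity**: for the flat mode `φ_C = |C|^{-1/2} 1_C` and a real `Ψ ≥ 0`,
`occ_{φ_C}(Ψ) = N |C|⁻¹ ∫ dŶ (∫_C Ψ(x :: Ŷ) dx)²` (`N = n + 1`, `|C| = (volume C).toReal`).
[folklore] -/
private theorem occupation_flatMode_eq {n : ℕ} {C : Set Space} (hC : MeasurableSet C)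
    {Ψ : Config (n + 1) → ℝ} (hΨ0 : ∀ X, 0 ≤ Ψ X) :
    occupation (n + 1) (C.indicator fun _ => ((Real.sqrt (volume C).toReal)⁻¹ : ℂ))
        (fun X => (Ψ X : ℂ)) =
      ((n + 1 : ℕ) : ℝ≥0∞) * (ENNReal.ofReal (volume C).toReal⁻¹ *
        ∫⁻ Y : Config n, ENNReal.ofReal (∫ x in C, Ψ (Matrix.vecCons x Y)) ^ 2) := by
  have hY : ∀ Y : Config n,
      ((‖∫ x, conj (C.indicator (fun _ => ((Real.sqrt (volume C).toReal)⁻¹ : ℂ)) x) *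
          (Ψ (Matrix.vecCons x Y) : ℂ)‖₊ : ℝ≥0∞)) ^ 2 =
        ENNReal.ofReal (volume C).toReal⁻¹ *
          ENNReal.ofReal (∫ x in C, Ψ (Matrix.vecCons x Y)) ^ 2 := by
    intro Y
    rw [← Complex.ofReal_inv, integral_conj_indicator_const_mul hC, sq_nnnorm_ofReal, mul_pow,
      inv_pow, Real.sq_sqrt ENNReal.toReal_nonneg,
      ENNReal.ofReal_mul (inv_nonneg.2 ENNReal.toReal_nonneg),
      ENNReal.ofReal_pow (integral_nonneg fun x => hΨ0 _)]
  simp only [occupation]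
  simp_rw [hY]
  rw [lintegral_const_mul' _ _ ENNReal.ofReal_ne_top, Nat.cast_succ]

/-! ### The event floor -/

/-- **Event floor for the flat mode**: if `X 0 ∈ C` and `a |C| Ψ(X) ≤ ∫_C Ψ(x :: X̂) dx` for all
`X ∈ E`, then `N a ∫_E Ψ² ≤ occ_{φ_C}(Ψ)` (`Ψ ≥ 0` measurable, `a ≥ 0`, `|C| < ∞`; `E` need not
be measurable). Pointwise `a Ψ² 1_E ≤ |C|⁻¹ 1_C(x₀) Ψ ∫_C Ψ(x :: X̂) dx` when `|C| > 0`, and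
`{x₀ ∈ C}` is null when `|C| = 0`. [folklore] -/
private theorem occupation_flatMode_floor {m : ℕ} {C : Set Space} (hC : MeasurableSet C)
    (hCfin : volume C ≠ ⊤) {a : ℝ} (ha : 0 ≤ a) {Ψ : Config (m + 1) → ℝ} (hΨm : Measurable Ψ)
    (hΨ0 : ∀ X, 0 ≤ Ψ X) {E : Set (Config (m + 1))}
    (hE : ∀ X ∈ E, X 0 ∈ C ∧
      a * (volume C).toReal * Ψ X ≤ ∫ x in C, Ψ (Matrix.vecCons x (Fin.tail X))) :
    ((m + 1 : ℕ) : ℝ≥0∞) * ENNReal.ofReal a *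
        ∫⁻ X, E.indicator (fun X => ENNReal.ofReal (Ψ X ^ 2)) X ≤
      occupation (m + 1) (C.indicator fun _ => ((Real.sqrt (volume C).toReal)⁻¹ : ℂ))
        (fun X => (Ψ X : ℂ)) := by
  rw [occupation_flatMode_eq hC hΨ0, lintegral_sq_fibre_eq hC hΨm hΨ0]
  set V : ℝ := (volume C).toReal
  set T : Set (Config (m + 1)) := {X | X 0 ∈ C}
  have hTm : MeasurableSet T := measurable_pi_apply 0 hC
  rcases eq_or_ne (volume C) 0 with hC0 | hC0
  · -- `C` is null: the event `{X 0 ∈ C} ⊇ E` is null in `(ℝ³)^N`, so the left side vanishes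
    have hT0 : volume T = 0 :=
      Measure.pi_eval_preimage_null (fun _ : Fin (m + 1) => (volume : Measure Space)) hC0
    have hle : ∫⁻ X, E.indicator (fun X => ENNReal.ofReal (Ψ X ^ 2)) X ≤
        ∫⁻ X, T.indicator (fun X => ENNReal.ofReal (Ψ X ^ 2)) X :=
      lintegral_mono fun X => Set.indicator_le_indicator_apply_of_subset
        (fun X hX => (hE X hX).1) zero_le
    rw [lintegral_indicator hTm, setLIntegral_measure_zero _ _ hT0, nonpos_iff_eq_zero] at hle
    rw [hle, mul_zero]
    exact zero_le
  · have hV0 : 0 < V := ENNReal.toReal_pos hC0 hCfin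
    -- pointwise: `a Ψ(X)² 1_E(X) ≤ |C|⁻¹ 1_C(X 0) Ψ(X) ∫_C Ψ(x :: X̂) dx`
    have hpt : ∀ X : Config (m + 1),
        ENNReal.ofReal a * E.indicator (fun X => ENNReal.ofReal (Ψ X ^ 2)) X ≤
          ENNReal.ofReal V⁻¹ * T.indicator (fun X => ENNReal.ofReal (Ψ X) *
            ENNReal.ofReal (∫ x in C, Ψ (Matrix.vecCons x (Fin.tail X)))) X := by
      intro X
      by_cases hX : X ∈ E
      · have hXT : X ∈ T := (hE X hX).1
        rw [Set.indicator_of_mem hX, Set.indicator_of_mem hXT, ← ENNReal.ofReal_mul ha,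
          ← ENNReal.ofReal_mul (hΨ0 X), ← ENNReal.ofReal_mul (inv_nonneg.2 hV0.le)]
        refine ENNReal.ofReal_le_ofReal ?_
        have h := mul_le_mul_of_nonneg_left (hE X hX).2 (hΨ0 X)
        calc a * Ψ X ^ 2 = V⁻¹ * V * (a * Ψ X ^ 2) := by rw [inv_mul_cancel₀ hV0.ne', one_mul]
          _ = V⁻¹ * (Ψ X * (a * V * Ψ X)) := by ring
          _ ≤ V⁻¹ * (Ψ X * ∫ x in C, Ψ (Matrix.vecCons x (Fin.tail X))) :=
              mul_le_mul_of_nonneg_left h (inv_nonneg.2 hV0.le)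
      · simp [Set.indicator_of_notMem hX]
    calc ((m + 1 : ℕ) : ℝ≥0∞) * ENNReal.ofReal a *
          ∫⁻ X, E.indicator (fun X => ENNReal.ofReal (Ψ X ^ 2)) X
        = ((m + 1 : ℕ) : ℝ≥0∞) *
            ∫⁻ X, ENNReal.ofReal a * E.indicator (fun X => ENNReal.ofReal (Ψ X ^ 2)) X := by
          rw [mul_assoc, lintegral_const_mul' _ _ ENNReal.ofReal_ne_top]
      _ ≤ ((m + 1 : ℕ) : ℝ≥0∞) * ∫⁻ X, ENNReal.ofReal V⁻¹ * T.indicator (fun X =>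
            ENNReal.ofReal (Ψ X) *
              ENNReal.ofReal (∫ x in C, Ψ (Matrix.vecCons x (Fin.tail X)))) X :=
          mul_le_mul_right (lintegral_mono hpt) _
      _ = _ := by rw [lintegral_const_mul' _ _ ENNReal.ofReal_ne_top]

/-- **Registered stub `stub_estimatorFloor`** (G1 of line `Sketch`, crux stmt-AtomisticToContinuum-9483;
the skeleton's `EstimatorFloor`, unfolded). [folklore] -/
theorem stub_estimatorFloor :
    ∀ (m : ℕ) (C : Set Space), MeasurableSet C → volume C ≠ ⊤ → ∀ (κ μ : ℝ), 0 ≤ κ → 0 ≤ μ →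
      ∀ (Ψ Φ : Config (m + 1) → ℝ), Measurable Ψ → (∀ X, 0 ≤ Ψ X) →
        ((m + 1 : ℕ) : ℝ≥0∞) * ENNReal.ofReal (κ * μ) *
            ∫⁻ X, Set.indicator
              ({X : Config (m + 1) | X 0 ∈ C ∧
                  μ * (volume C).toReal * Φ X ≤ ∫ x in C, Φ (Matrix.vecCons x (Fin.tail X))} \
                {X : Config (m + 1) | X 0 ∈ C ∧ (Φ X ≤ 0 ∨
                  (∫ x in C, Ψ (Matrix.vecCons x (Fin.tail X))) * Φ X <
                    κ * ((∫ x in C, Φ (Matrix.vecCons x (Fin.tail X))) * Ψ X))})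
              (fun X => ENNReal.ofReal (Ψ X ^ 2)) X ≤
          occupation (m + 1) (C.indicator fun _ => ((Real.sqrt (volume C).toReal)⁻¹ : ℂ))
            (fun X => (Ψ X : ℂ)) := by
  intro m C hC hCfin κ μ hκ hμ Ψ Φ hΨm hΨ0
  refine occupation_flatMode_floor hC hCfin (mul_nonneg hκ hμ) hΨm hΨ0 ?_
  rintro X ⟨⟨hXC, h2⟩, h1⟩
  refine ⟨hXC, ?_⟩
  -- on the good event minus the bad one: `Φ X > 0` and `(∫_C Ψ) Φ X ≥ κ (∫_C Φ) Ψ X ≥ κ μ |C| Φ X Ψ X`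
  have h1' : 0 < Φ X ∧ κ * ((∫ x in C, Φ (Matrix.vecCons x (Fin.tail X))) * Ψ X) ≤
      (∫ x in C, Ψ (Matrix.vecCons x (Fin.tail X))) * Φ X := by
    by_contra h
    refine h1 ⟨hXC, ?_⟩
    rcases le_or_gt (Φ X) 0 with hΦ | hΦ
    · exact Or.inl hΦ
    · exact Or.inr (lt_of_not_ge fun hge => h ⟨hΦ, hge⟩)
  obtain ⟨hΦ, hk⟩ := h1'
  refine le_of_mul_le_mul_right ?_ hΦ
  calc κ * μ * (volume C).toReal * Ψ X * Φ X = κ * ((μ * (volume C).toReal * Φ X) * Ψ X) := by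
        ring
    _ ≤ κ * ((∫ x in C, Φ (Matrix.vecCons x (Fin.tail X))) * Ψ X) :=
        mul_le_mul_of_nonneg_left (mul_le_mul_of_nonneg_right h2 (hΨ0 X)) hκ
    _ ≤ (∫ x in C, Ψ (Matrix.vecCons x (Fin.tail X))) * Φ X := hk

end Summit.AtomisticToContinuum.BoseEinsteinCondensation.TorusInTheBox

end
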